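import Literature.AlgebraicGeometry.Motives.FrobeniusMorphism
import HarnessLib

/-!
# The `q`-Frobenius acts bijectively on geometric points ([Milne2025] V Cor. 2.6, proof)

Topic `Literature/AlgebraicGeometry/Motives`, namespace `Literature.AlgebraicGeometry.Motives`.  THEOREMS ONLY (no definition, no named fact,
no instance, no `sorry`).  Cell `hodgecm-mathlib` (D-0151), FLOOR 0, programme F0P5a (D9op road 2′, crux item stmt-HodgeConjecture-24832): piece
**Fbij** of the C2 package (planner ED4-CUT-LETTER v0 §1; census `F0/P5a/C2-PACKAGE-census.v0.F0P5a-p02g0.md`): the ED4 composition (§4) replaces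
a geometric point `z̄` of the special fibre by `F⁻¹ z̄′`, which needs the `q`-Frobenius `F_{Z/k}` (★ `frobeniusOver Z`) to be a BIJECTION of
`Z(k̄)`.  Proof: on `k̄`-points, composition with `F_{Z/k}` IS the action of the arithmetic Frobenius `φ ∈ Gal(k̄/k)` (★
`arithFrob_smul_eq_map_frobeniusOver`, [Milne2025] V Cor. 2.6 «`F` acts on `X̄(k_s)` by raising the coordinates of any point to the `q`-th
power»), and a group acts by bijections.

* `map_frobeniusOver_bijective` — `AlgPoints.map (frobeniusOver Z) : Z(k̄) → Z(k̄)` is bijective (also `…_injective`, `…_surjective`);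
* `iterate_map_frobeniusOver_bijective` — so is every iterate `Fᵐ`.

HC_CM is proved only modulo the 7 printed citations until rung 0 closes; this file is a generic leaf and changes no count.

## References
* [Milne2025] J. S. Milne, *Lectures on Étale Cohomology*, V Cor. 2.6 (proof, p. 197).
* [Hartshorne1977] R. Hartshorne, *Algebraic Geometry*, App. C §4 (the Frobenius morphism and its fixed points).
-/

set_option autoImplicit false

noncomputable section

open CategoryTheory AlgebraicGeometry

namespace Literature.AlgebraicGeometry.Motives

universe u

variable {k : Type u} [Field k] [Finite k] (Z : SchemeOver k)

/-- **The `q`-Frobenius is a bijection of `Z(k̄)`**: composition with `F_{Z/k}` is the action of the arithmetic Frobenius `φ ∈ Gal(k̄/k)`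
(★ `arithFrob_smul_eq_map_frobeniusOver`), and `φ` acts by a bijection with inverse the action of `φ⁻¹`.
[cite: Milne2025, V Cor. 2.6 (proof, p. 197)] -/
theorem map_frobeniusOver_bijective :
    Function.Bijective (AlgPoints.map (frobeniusOver Z) : AlgPoints Z (AlgebraicClosure k) → AlgPoints Z (AlgebraicClosure k)) := by
  have h : (AlgPoints.map (frobeniusOver Z) : AlgPoints Z (AlgebraicClosure k) → AlgPoints Z (AlgebraicClosure k)) =
      fun P => arithFrob k • P := funext fun P => (arithFrob_smul_eq_map_frobeniusOver P).symm
  rw [h]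
  exact MulAction.bijective (arithFrob k)

/-- The `q`-Frobenius is injective on `Z(k̄)`. [cite: Milne2025, V Cor. 2.6 (proof, p. 197)] -/
theorem map_frobeniusOver_injective :
    Function.Injective (AlgPoints.map (frobeniusOver Z) : AlgPoints Z (AlgebraicClosure k) → AlgPoints Z (AlgebraicClosure k)) :=
  (map_frobeniusOver_bijective Z).1

/-- The `q`-Frobenius is surjective on `Z(k̄)`: every geometric point is `F` of a (unique) geometric point.
[cite: Milne2025, V Cor. 2.6 (proof, p. 197)] -/
theorem map_frobeniusOver_surjective :
    Function.Surjective (AlgPoints.map (frobeniusOver Z) : AlgPoints Z (AlgebraicClosure k) → AlgPoints Z (AlgebraicClosure k)) :=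
  (map_frobeniusOver_bijective Z).2

/-- Every iterate `Fᵐ` of the `q`-Frobenius is a bijection of `Z(k̄)` (it is the action of `φᵐ`, ★ `arithFrob_pow_smul_eq_iterate_map_frobeniusOver`).
[cite: Milne2025, V Cor. 2.6 (proof, p. 197)] [cite: Hartshorne1977, App. C §4] -/
theorem iterate_map_frobeniusOver_bijective (m : ℕ) :
    Function.Bijective ((AlgPoints.map (frobeniusOver Z))^[m] : AlgPoints Z (AlgebraicClosure k) → AlgPoints Z (AlgebraicClosure k)) :=
  Function.Bijective.iterate (map_frobeniusOver_bijective Z) m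

end Literature.AlgebraicGeometry.Motives

end
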